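import Mathlib
import Summits.ResolutionOfSingularities.ResolutionOfSingularities.Theorems.WeightedInvariantLocalWeightedDropNCBranchPrimesKey
import Summits.ResolutionOfSingularities.ResolutionOfSingularities.Theorems.WeightedInvariantLocalWeightedDropNCResSettingStrict
import Summits.ResolutionOfSingularities.ResolutionOfSingularities.Theorems.WeightedInvariantLocalWeightedDropNCPolyBridgeRepresents

/-!
# `LocalWeightedDrop`, TOT2-LINE regime (P), piece (β-prime): ALL-BRANCHES FINITENESS IN PRIME FORM — a squarefree germ `b ∈ k⟦u₁,u₂,y⟧`
# lies in `P^d` (`d ≥ 2`) for only finitely many non-maximal primes `P`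

Crux item stmt-ResolutionOfSingularities-8899 `WeightedInvariant.LocalWeightedDrop` (route `ResolutionOfSingularities/WeightedInvariant`), ENGINE
skeleton v33 (35b29332b4d99231), registered stub `stub_regimePresented`, piece (P3) (res-type-088's conflict budget; NAMING res-type-088
2026-08-27T16:46:34Z (4) «(β-prime) all-branches finiteness in prime form», queue order res-L1-w43-plan-1 16:59:11Z (2)).  [OURS · L1 W4.3 · chain w43
· seat res-L1-w43-stub-1 gen 6; def-free; commutative algebra from Mathlib (`Ideal.minimalPrimes`, heights, `Ideal.finite_minimalPrimes_of_isNoetherianRing`)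
and the tree (`isNoetherianRing_mvPowerSeries`, `ringKrullDim_mvPowerSeries`, `uniqueFactorizationMonoid_mvPowerSeries`, `MvPowerSeries.pderiv`) plus the
key `NCBranchPrimes.not_forall_dvd_pderiv` (…NCBranchPrimesKey); nothing here is a statement of any manuscript; AI-produced, gate-checked, weaker than
expert review.]

THE STATEMENT (`finite_primes_of_mem_pow`).  `k` perfect of characteristic `p`, `b ∈ k⟦X₀,X₁,X₂⟧` squarefree, `d ≥ 2`.  Then
`{P prime | P ≠ 𝔪, b ∈ P^d}` is finite; in particular (`finite_primes_of_monicGerm_mem_pow`) for the monic germ `y^d + Σ A_j y^j` of a label with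
squarefree germ — the index set («top-locus branches in prime form») of res-type-088's budget.

THE PROOF.  `J := (b, ∂₀b, ∂₁b, ∂₂b)`.  (1) `b ∈ P^d ⇒ ∂ᵢb ∈ P^{d-1} ⊆ P` (`derivation_apply_mem_pow`), so `J ≤ P`.  (2) No prime ELEMENT `g` has
`J ≤ (g)`: `g ∣ b = gc` with `g ∤ c` (squarefree) and `g ∣ ∂ᵢb = c∂ᵢg + g∂ᵢc` give `g ∣ ∂ᵢg` for all `i`, against the key
(`not_span_singleton_of_prime`).  (3) Every `P` of the set is a MINIMAL prime of `J` (`mem_minimalPrimes`): a prime `Q` with `J ≤ Q < P` contains a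
prime element `g` (`k⟦X⟧` is factorial), `(g) ≠ Q` by (2), and then `⊥ < (g) < Q < P < 𝔪` is a chain of primes of length `4` in a ring of Krull
dimension `3` (`no_chain_four`).  (4) The minimal primes of `J` are finitely many (`k⟦X⟧` is Noetherian).
-/

set_option linter.dupNamespace false -- mandated namespace of this single-conjunct summit

noncomputable section

namespace Summit.ResolutionOfSingularities.ResolutionOfSingularities.Theorems

namespace NCBranchPrimes

open MvPowerSeries Literature.AlgebraicGeometry.Resolution

variable {k : Type} [Field k]

/-! ## Derivations lower powers of ideals by one -/

/-- A derivation maps `P^{n+1}` into `P^n`. -/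
theorem derivation_apply_mem_pow {R₀ A : Type*} [CommSemiring R₀] [CommRing A] [Algebra R₀ A] (D : Derivation R₀ A A) (P : Ideal A) (n : ℕ) :
    ∀ x ∈ P ^ (n + 1), D x ∈ P ^ n := by
  induction n with
  | zero =>
    intro x _
    rw [pow_zero, Ideal.one_eq_top]
    exact Submodule.mem_top
  | succ n ih =>
    intro x hx
    rw [pow_succ'] at hx
    refine Submodule.mul_induction_on hx ?_ ?_
    · intro a ha y hy
      rw [Derivation.leibniz, smul_eq_mul, smul_eq_mul]
      refine Ideal.add_mem _ ?_ (Ideal.mul_mem_right _ _ hy)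
      rw [pow_succ']
      exact Ideal.mul_mem_mul ha (ih y hy)
    · intro x y hx hy
      rw [map_add]
      exact Ideal.add_mem _ hx hy

/-- `b ∈ P^d`, `d ≥ 2` ⇒ `∂ᵢ b ∈ P`. -/
theorem pderiv_mem_of_mem_pow {σ : Type} {P : Ideal (MvPowerSeries σ k)} {b : MvPowerSeries σ k} {d : ℕ} (hd : 2 ≤ d) (hb : b ∈ P ^ d)
    (i : σ) : MvPowerSeries.pderiv i b ∈ P := by
  obtain ⟨n, rfl⟩ : ∃ n, d = n + 1 + 1 := ⟨d - 2, by omega⟩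
  have h1 := derivation_apply_mem_pow (MvPowerSeries.pderiv i) P (n + 1) b hb
  exact Ideal.pow_le_self (Nat.succ_ne_zero n) h1

/-! ## No prime element divides `b` and all `∂ᵢ b` -/

/-- For a squarefree `b` over a perfect field of characteristic `p`, no prime `g` divides `b` and all its partial derivatives. -/
theorem not_prime_dvd_all {σ : Type} [Fintype σ] (p : ℕ) [Fact p.Prime] [CharP k p] [PerfectRing k p] {b g : MvPowerSeries σ k}
    (hb : Squarefree b) (hg : Prime g) (hgb : g ∣ b) (hgd : ∀ i, g ∣ MvPowerSeries.pderiv i b) : False := by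
  obtain ⟨c, rfl⟩ := hgb
  have hgc : ¬ g ∣ c := by
    intro h
    exact hg.not_unit (hb g (mul_dvd_mul_left g h))
  refine not_forall_dvd_pderiv p hg.irreducible fun i => ?_
  have h1 := hgd i
  rw [Derivation.leibniz, smul_eq_mul, smul_eq_mul] at h1
  have h2 : g ∣ c * MvPowerSeries.pderiv i g := (dvd_add_right (Dvd.intro _ rfl)).mp h1
  exact (hg.dvd_or_dvd h2).resolve_left hgc

/-! ## No chain of four primes in `k⟦X₀,X₁,X₂⟧` -/

/-- `dim k⟦X₀,X₁,X₂⟧ = 3`: there is no chain `P₀ < P₁ < P₂ < P₃ < P₄` of prime ideals. -/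
theorem no_chain_four {P₀ P₁ P₂ P₃ P₄ : Ideal (MvPowerSeries (Fin 3) k)} [P₀.IsPrime] [P₁.IsPrime] [P₂.IsPrime] [P₃.IsPrime] [P₄.IsPrime]
    (h₁ : P₀ < P₁) (h₂ : P₁ < P₂) (h₃ : P₂ < P₃) (h₄ : P₃ < P₄) : False := by
  have hdim : ringKrullDim (MvPowerSeries (Fin 3) k) = ((3 : ℕ∞) : WithBot ℕ∞) := by
    rw [ringKrullDim_mvPowerSeries k (Fin 3), Nat.card_eq_fintype_card, Fintype.card_fin]
    norm_cast
  have e1 := Ideal.height_add_one_le_of_lt_of_isPrime h₁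
  have e2 := Ideal.height_add_one_le_of_lt_of_isPrime h₂
  have e3 := Ideal.height_add_one_le_of_lt_of_isPrime h₃
  have e4 := Ideal.height_add_one_le_of_lt_of_isPrime h₄
  have e5 : (P₄.height : WithBot ℕ∞) ≤ ((3 : ℕ∞) : WithBot ℕ∞) := by
    have h := Ideal.height_le_ringKrullDim_of_isPrime (I := P₄)
    rwa [hdim] at h
  have e5' : P₄.height ≤ 3 := WithBot.coe_le_coe.mp e5
  have a1 : (1 : ℕ∞) ≤ P₁.height := le_trans le_add_self e1
  have a2 : (1 + 1 : ℕ∞) ≤ P₂.height := le_trans (by gcongr) e2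
  have a3 : (1 + 1 + 1 : ℕ∞) ≤ P₃.height := le_trans (by gcongr) e3
  have a4 : (1 + 1 + 1 + 1 : ℕ∞) ≤ P₄.height := le_trans (by gcongr) e4
  have h5 : (1 + 1 + 1 + 1 : ℕ∞) ≤ 3 := a4.trans e5'
  have h6 : (1 + 1 + 1 + 1 : ℕ) ≤ 3 := by exact_mod_cast h5
  omega

/-! ## The finiteness -/

/-- MINIMALITY.  For squarefree `b` and `d ≥ 2`, every non-maximal prime `P` with `b ∈ P^d` is a minimal prime of `J = (b, ∂₀b, ∂₁b, ∂₂b)`. -/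
theorem mem_minimalPrimes (p : ℕ) [Fact p.Prime] [CharP k p] [PerfectRing k p] {b : MvPowerSeries (Fin 3) k} (hb : Squarefree b) {d : ℕ}
    (hd : 2 ≤ d) {P : Ideal (MvPowerSeries (Fin 3) k)} (hP : P.IsPrime) (hPm : P ≠ IsLocalRing.maximalIdeal (MvPowerSeries (Fin 3) k))
    (hbP : b ∈ P ^ d) :
    P ∈ (Ideal.span (insert b (Set.range fun i => MvPowerSeries.pderiv i b))).minimalPrimes := by
  classical
  haveI := TameFourTupleDrop.uniqueFactorizationMonoid_mvPowerSeries (k := k) 3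
  have hb0 : b ≠ 0 := hb.ne_zero
  -- (1) `J ≤ P`
  have hJle : ∀ Q : Ideal (MvPowerSeries (Fin 3) k), b ∈ Q → (∀ i, MvPowerSeries.pderiv i b ∈ Q) →
      Ideal.span (insert b (Set.range fun i => MvPowerSeries.pderiv i b)) ≤ Q := by
    intro Q hbQ hdQ
    rw [Ideal.span_le]
    rintro x (rfl | ⟨i, rfl⟩)
    · exact hbQ
    · exact hdQ i
  have hJP : Ideal.span (insert b (Set.range fun i => MvPowerSeries.pderiv i b)) ≤ P :=
    hJle P (Ideal.pow_le_self (by omega) hbP) (pderiv_mem_of_mem_pow hd hbP)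
  refine ⟨⟨hP, hJP⟩, ?_⟩
  rintro Q ⟨hQ, hJQ⟩ hQP
  by_contra hPQ
  have hQP' : Q < P := lt_of_le_of_ne hQP (fun h => hPQ h.symm.le)
  -- `Q ≠ ⊥` contains a prime element `g`
  have hbQ : b ∈ Q := hJQ (Ideal.subset_span (Set.mem_insert _ _))
  have hQ0 : Q ≠ ⊥ := fun h => hb0 (by rw [h, Ideal.mem_bot] at hbQ; exact hbQ)
  obtain ⟨g, hgQ, hg⟩ := hQ.exists_mem_prime_of_ne_bot hQ0
  have hgQ' : Ideal.span {g} ≤ Q := (Ideal.span_singleton_le_iff_mem _).mpr hgQ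
  by_cases hgQe : Ideal.span {g} = Q
  · -- `J ≤ (g)`: `g` divides `b` and all `∂ᵢ b`
    rw [← hgQe] at hJQ
    refine not_prime_dvd_all p hb hg ?_ ?_
    · exact Ideal.mem_span_singleton.mp (hJQ (Ideal.subset_span (Set.mem_insert _ _)))
    · intro i
      exact Ideal.mem_span_singleton.mp (hJQ (Ideal.subset_span (Set.mem_insert_of_mem _ ⟨i, rfl⟩)))
  · -- a chain of length `4`
    have h1 : (⊥ : Ideal (MvPowerSeries (Fin 3) k)) < Ideal.span {g} := by
      rw [bot_lt_iff_ne_bot, Ne, Ideal.span_singleton_eq_bot]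
      exact hg.ne_zero
    have h2 : Ideal.span {g} < Q := lt_of_le_of_ne hgQ' hgQe
    have h4 : P < IsLocalRing.maximalIdeal _ := lt_of_le_of_ne (IsLocalRing.le_maximalIdeal hP.ne_top) hPm
    haveI : (Ideal.span {g}).IsPrime := (Ideal.span_singleton_prime hg.ne_zero).mpr hg
    haveI := hQ
    haveI := hP
    exact no_chain_four h1 h2 hQP' h4

/-- **(β-prime) ALL-BRANCHES FINITENESS IN PRIME FORM.**  `k` perfect of characteristic `p`, `b ∈ k⟦X₀,X₁,X₂⟧` squarefree, `d ≥ 2`: only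
finitely many non-maximal primes `P` have `b ∈ P^d`. -/
theorem finite_primes_of_mem_pow (p : ℕ) [Fact p.Prime] [CharP k p] [PerfectRing k p] {b : MvPowerSeries (Fin 3) k} (hb : Squarefree b)
    {d : ℕ} (hd : 2 ≤ d) :
    Set.Finite {P : Ideal (MvPowerSeries (Fin 3) k) | P.IsPrime ∧ P ≠ IsLocalRing.maximalIdeal (MvPowerSeries (Fin 3) k) ∧ b ∈ P ^ d} := by
  haveI : IsNoetherianRing (MvPowerSeries (Fin 3) k) := isNoetherianRing_mvPowerSeries k (Fin 3)
  refine (Ideal.finite_minimalPrimes_of_isNoetherianRing (MvPowerSeries (Fin 3) k)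
    (Ideal.span (insert b (Set.range fun i => MvPowerSeries.pderiv i b)))).subset ?_
  rintro P ⟨hP, hPm, hbP⟩
  exact mem_minimalPrimes p hb hd hP hPm hbP

/-- (β-prime) for the MONIC GERM of a label `A : Fin d → k⟦u₁,u₂⟧` (`d ≥ 2`) with squarefree germ — res-type-088's index set of top-locus
branches in prime form. -/
theorem finite_primes_of_monicGerm_mem_pow (p : ℕ) [Fact p.Prime] [CharP k p] [PerfectRing k p] {d : ℕ} (hd : 2 ≤ d)
    (A : Fin d → MvPowerSeries (Fin 2) k) (hsq : Squarefree (NCPoly.monicGerm d A)) :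
    Set.Finite {P : Ideal (MvPowerSeries (Fin 3) k) | P.IsPrime ∧ P ≠ IsLocalRing.maximalIdeal (MvPowerSeries (Fin 3) k) ∧
      NCPoly.monicGerm d A ∈ P ^ d} :=
  finite_primes_of_mem_pow p hsq hd

/-- (β-prime) over an algebraically closed field (the TOT2-LINE setting). -/
theorem finite_primes_of_monicGerm_mem_pow_of_isAlgClosed (p : ℕ) [Fact p.Prime] [CharP k p] [IsAlgClosed k] {d : ℕ} (hd : 2 ≤ d)
    (A : Fin d → MvPowerSeries (Fin 2) k) (hsq : Squarefree (NCPoly.monicGerm d A)) :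
    Set.Finite {P : Ideal (MvPowerSeries (Fin 3) k) | P.IsPrime ∧ P ≠ IsLocalRing.maximalIdeal (MvPowerSeries (Fin 3) k) ∧
      NCPoly.monicGerm d A ∈ P ^ d} :=
  finite_primes_of_mem_pow p hsq hd

end NCBranchPrimes

end Summit.ResolutionOfSingularities.ResolutionOfSingularities.Theorems

end
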